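/-
Copyright (c) 2026 the pub-hodgecm-mathlib formalisation cell (harness21).  Prover seat hodgecm-mathlib-K2Liu-p10 (g4), Track B «K2-LIT»,
#184♮ = hLiu418 = `stmt-HodgeConjecture-24832`; (σ) endgame organ, SMALL SIDE, S-2c part (e): the slice `u = 0` of the Kudla–Rallis frame lies in the null cone.  KERNEL: theorems only.
-/
import Summits.HodgeConjecture.HodgeConjecture.Theorems.K2LiuKRFrameSliceLetter   -- ★ S-1 part 2b (`hermForm_eq_of_frame`, `hermForm_witt`; brings Components, S-0a, I-0)
import HarnessLib

/-!
# Crux `HLiu418`, (σ) small side, S-2c part (e): THE INTEGRATED BLOCK IS ISOTROPIC — the Gram matrix of a slice point `θ⁻¹((0 ⊔ 0) ⊔ t)` vanishes (`hq0` of ★ S-2b `krSection_unip_mul`)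

Cell `hodgecm-mathlib`, crux item hLiu418 = `stmt-HodgeConjecture-24832`, route of record `HCCMUnconditional`; squad K2 ∕ K2Liu, prover K2Liu-p10 (g4).
THEOREMS ONLY; lane `--supports stmt-HodgeConjecture-24832 --as helper`.  D10 currency of ★ S-0a `(F E c hcδ hδ v n eV P A)`.

For `θ = krFrameTw eV P A` the slice point `y = θ⁻¹((0 ⊔ 0) ⊔ t)` has Witt matrix with ONLY the `x′`-column (★ `wittMatrix_krFrameTw_symm_slice`); since the Witt Gram has
`W₀₀ = ⟨x′, x′⟩ = 0`, every pairing `h_J(X i, X j)` of rows of its coordinate matrix `X = matOfVec eV (R⁻¹ y)` vanishes for ANY `J` framed by `P` onto such a `W`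
(`(Pσ)ᵀ·W·P = J`): **`hermForm_rows_slice_eq_zero`** (entry `(i,j)` of `(Xσ)·J·Xᵀ`).
At the CM instance `X = bmat (R⁻¹ y)` (★ p02 `bmat` = `matOfVec (epsV …)` by `rfl`) and `J = J′_v`, so ★ p02 `gramLoc (R⁻¹ y) = 0`, i.e. `qHerm y = 0` (★ `qHerm_eq_zero_iff`) — the
letter `hq0` of ★ S-2b `krSection_unip_mul` (the unipotent half of V8e's `hSiegS`).

HONEST LABEL: HC_CM is proved only modulo the 7 printed citations (2 remaining named inputs: hLiu418 = stmt-HodgeConjecture-24832, h413 = stmt-HodgeConjecture-24833)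
until rung 0 closes; helper, closes no item.
References: [KudlaRallis1994] §1–§2 (the isotropic subspace `X′ ⊗ W` of the mixed model); [Kudla1994] §3 Thm. 3.1 (the null cone).
-/

set_option autoImplicit false
set_option linter.dupNamespace false -- the mandated namespace repeats `HodgeConjecture.HodgeConjecture`

noncomputable section

open scoped Matrix
open NumberField IsDedekindDomain Matrix
open Literature.NumberTheory.Automorphic Literature.NumberTheory.Automorphic.UnitaryGroup
open Summit.HodgeConjecture.HodgeConjecture.Cruxes.HLiu418.K2LiuDeltaModelRealFrame
open Summit.HodgeConjecture.HodgeConjecture.Cruxes.HLiu418.K2LiuKRFrameDefs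
open Summit.HodgeConjecture.HodgeConjecture.Cruxes.HLiu418.K2LiuKRFrameComponents
open Summit.HodgeConjecture.HodgeConjecture.Cruxes.HLiu418.K2LiuKRFrameSliceLetter

namespace Summit.HodgeConjecture.HodgeConjecture.Cruxes.HLiu418.K2LiuKRFrameSliceNullCone

variable (F : Type) [Field F] [NumberField F] (E : Type) [Field E] [NumberField E] [Algebra F E]
  [Algebra.IsQuadraticExtension F E] (c : E ≃ₐ[F] E)
  {δ : E} (hcδ : c δ = -δ) (hδ : δ ≠ 0) (v : HeightOneSpectrum (𝓞 F)) (n : ℕ) {n₃ : ℕ} (eV : Fin n × Fin 3 ≃ Fin n₃)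
  (P : GL (Fin 3) (LocalRing E v)) (A : (Fin (n + n) → v.adicCompletion F) ≃ₗ[v.adicCompletion F] (Fin (n + n) → v.adicCompletion F))

omit [Algebra.IsQuadraticExtension F E] in
/-- a `σ`-hermitian pairing with matrix `W`, `W₀₀ = 0`, vanishes on vectors supported on the index `0`. [cite: KudlaRallis1994, §1] -/
theorem hermForm_eq_zero_of_support_zero (W : Matrix (Fin 3) (Fin 3) (LocalRing E v)) (hW : W 0 0 = 0) (Y Y' : Fin 3 → LocalRing E v)
    (hY1 : Y 1 = 0) (hY2 : Y 2 = 0) (hY'1 : Y' 1 = 0) (hY'2 : Y' 2 = 0) :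
    hermForm (conjLocal E c v : LocalRing E v →+* LocalRing E v) W Y Y' = 0 := by
  rw [hermForm_apply, dotProduct, Fin.sum_univ_three]
  simp only [Function.comp_apply, Matrix.mulVec, dotProduct, Fin.sum_univ_three, hY1, hY2, hY'1, hY'2, hW, map_zero, mul_zero, zero_mul, add_zero]

/-- **THE SLICE IS ISOTROPIC**: for `J = (Pσ)ᵀ·W·P` with `W₀₀ = 0`, all row pairings `h_J(X i, X j)` of the coordinate matrix `X` of a slice point `θ⁻¹((0 ⊔ 0) ⊔ t)` vanish.
[cite: KudlaRallis1994, §1] [cite: Kudla1994, §3 Thm. 3.1] -/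
theorem hermForm_rows_slice_eq_zero (W J : Matrix (Fin 3) (Fin 3) (LocalRing E v)) (hW : W 0 0 = 0)
    (hPJ : (P.val.map (conjLocal E c v : LocalRing E v →+* LocalRing E v))ᵀ * W * P.val = J) (t : Fin (n + n) → v.adicCompletion F) (i j : Fin n) :
    hermForm (conjLocal E c v : LocalRing E v →+* LocalRing E v) J
        (matOfVec F E v n eV ((reFrame F E c hcδ hδ v n₃).symm ((krFrameTw F E c hcδ hδ v n eV P A).symm (Sum.elim (Sum.elim (0 : Fin (n + n) → v.adicCompletion F) (0 : Fin (n + n) → v.adicCompletion F)) t))) i)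
        (matOfVec F E v n eV ((reFrame F E c hcδ hδ v n₃).symm ((krFrameTw F E c hcδ hδ v n eV P A).symm (Sum.elim (Sum.elim (0 : Fin (n + n) → v.adicCompletion F) (0 : Fin (n + n) → v.adicCompletion F)) t))) j) = 0 := by
  rw [hermForm_eq_of_frame (conjLocal E c v : LocalRing E v →+* LocalRing E v) hPJ]
  obtain ⟨-, hi1, hi2⟩ := wittMatrix_krFrameTw_symm_slice F E c hcδ hδ v n eV P A (0 : Fin (n + n) → v.adicCompletion F) t i
  obtain ⟨-, hj1, hj2⟩ := wittMatrix_krFrameTw_symm_slice F E c hcδ hδ v n eV P A (0 : Fin (n + n) → v.adicCompletion F) t j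
  rw [map_zero, Pi.zero_apply] at hi2 hj2
  rw [colMix_apply] at hi1 hi2 hj1 hj2
  exact hermForm_eq_zero_of_support_zero F E c v W hW _ _ hi1 hi2 hj1 hj2

end Summit.HodgeConjecture.HodgeConjecture.Cruxes.HLiu418.K2LiuKRFrameSliceNullCone

end
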